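import Summits.QuantumFields.YangMills.Theorems.ColdStartUniversalityLatticeLangevinCoordCovariation
import HarnessLib

/-!
# Route `ColdStartUniversality`, rung `stub_fixedCutoffMixing` of K_A1 (stmt-QuantumFields-24809):
# the martingale terms of one Taylor cell

Helper file (seat `ym-line-csu-p1`, g6) for the `WilsonMeasureLangevinInvariant` wall of the rung
(step 2, Taylor route to Dynkin's formula in expectation for Itô processes driven by a Brownian
vector, JOINT filtration).  Over a cell `(u, v]` the martingale part of the increment of the
`i`-th component is `N_i = ∑_k (J_{ik}(v) - J_{ik}(u))`, `J_{ik} = ∫ σ_{ik} dW^k`, `|σ| ≤ M`.  For a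
bounded `𝓕_u`-measurable weight `G` (in the application `G = Z ∂_i f(X_u)` or `Z ∂²_{ij} f(X_u)`):

* `integral_mul_martingalePart_eq_zero` — **first order**: `E[G N_i] = 0`;
* `integral_mul_martingalePart_mul_martingalePart` — **second order**:
  `E[G N_i N_j] = ∑_k E[G ∫_{(u,v]} σ_{ik} σ_{jk} dr]` (zero cross-variation of different
  coordinates, conditional isometry on the diagonal: file `…CoordCovariation`).

Also `sqErr_ne_top_of_bdd` (bounded integrands are square integrable on every horizon).
No definition, no sorry, standard axioms.  RECORD-rung plumbing (R3); the Yang–Mills mass gap is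
NOT proved.
-/

set_option autoImplicit false

noncomputable section

namespace Summit.QuantumFields.YangMills.Theorems.ColdStartUniversality

open MeasureTheory ProbabilityTheory Filter Finset
open scoped NNReal ENNReal Topology
open Literature.Probability.Process

/-- A bounded integrand has `E ∫₀ᵗ H² < ∞` for every `t`. [folklore] -/
theorem sqErr_ne_top_of_bdd {Ω : Type*} {mΩ : MeasurableSpace Ω} {μ : Measure Ω} [IsFiniteMeasure μ]
    {H : ℝ≥0 → Ω → ℝ} {M : ℝ} (hM : ∀ r ω, |H r ω| ≤ M) (t : ℝ≥0) : sqErr H 0 μ t ≠ ∞ := by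
  have hle : sqErr H 0 μ t ≤ ∫⁻ _, (∫⁻ _ in Set.Icc (0 : ℝ) t, ENNReal.ofReal (M ^ 2)) ∂μ := by
    unfold sqErr
    refine lintegral_mono fun ω ↦ lintegral_mono fun x ↦ ENNReal.ofReal_le_ofReal ?_
    rw [Pi.zero_apply, Pi.zero_apply, sub_zero, ← sq_abs]
    exact pow_le_pow_left₀ (abs_nonneg _) (hM _ ω) 2
  have hfin : ∫⁻ _, (∫⁻ _ in Set.Icc (0 : ℝ) t, ENNReal.ofReal (M ^ 2)) ∂μ ≠ ∞ := by
    rw [lintegral_const, lintegral_const, Measure.restrict_apply_univ, Real.volume_Icc]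
    exact ENNReal.mul_ne_top (ENNReal.mul_ne_top ENNReal.ofReal_ne_top ENNReal.ofReal_ne_top)
      (measure_ne_top _ _)
  exact ne_top_of_le_ne_top hfin hle

section Vec

variable {Ω : Type*} {mΩ : MeasurableSpace Ω} {P : Measure Ω} [IsProbabilityMeasure P] {d : ℕ}
  {W : ℝ≥0 → Ω → (Fin d → ℝ)} {M : ℝ} {u v : ℝ≥0} {G : Ω → ℝ} {CG : ℝ}

/-- **First-order martingale term of a Taylor cell vanishes**: `E[G ∑_k (J_k(v) - J_k(u))] = 0` for
`J_k = ∫ σ_k dW^k` (`|σ_k| ≤ M` progressive) and `G` bounded `𝓕_u`-measurable. [folklore] -/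
theorem integral_mul_martingalePart_eq_zero (hW : IsBrownianVec W P) {σ J : Fin d → ℝ≥0 → Ω → ℝ}
    (hσ : ∀ k, IsStronglyProgressive hW.natFiltration (σ k)) (hσM : ∀ k r ω, |σ k r ω| ≤ M)
    (hJ : ∀ k, IsItoIntegral (σ k) (fun r ω => W r ω k) (J k) hW.natFiltration P)
    (huv : u ≤ v) (hG : StronglyMeasurable[hW.natFiltration u] G) (hGb : ∀ ω, |G ω| ≤ CG) :
    ∫ ω, G ω * ∑ k, (J k v ω - J k u ω) ∂P = 0 := by
  have hGm : AEStronglyMeasurable G P := (hG.mono (hW.natFiltration.le u)).aestronglyMeasurable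
  have hG2 : MemLp G 2 P := by
    have h : MemLp (fun ω ↦ G ω * 1) 2 P := memLp_two_bdd_mul hGm hGb (memLp_const 1)
    simpa using h
  have hJ2 : ∀ k (r : ℝ≥0), MemLp (J k r) 2 P := fun k r ↦
    IsItoIntegral.memLp_two (martingale_coord hW k) (martingale_coord_sq_sub hW k)
      (memLp_two_coord hW · k) (continuous_coord hW k) (hσ k) (sqErr_ne_top_of_bdd (hσM k)) (hJ k) r
  have hint : ∀ k, Integrable (fun ω ↦ G ω * (J k v ω - J k u ω)) P := fun k ↦
    hG2.integrable_mul ((hJ2 k v).sub (hJ2 k u))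
  simp_rw [mul_sum]
  rw [integral_finsetSum _ fun k _ ↦ hint k]
  refine sum_eq_zero fun k _ ↦ ?_
  exact IsItoIntegral.integral_mul_sub_eq_zero (martingale_coord hW k) (martingale_coord_sq_sub hW k)
    (memLp_two_coord hW · k) (continuous_coord hW k) (hσ k) (sqErr_ne_top_of_bdd (hσM k)) (hJ k)
    huv hG hG2

/-- **Second-order martingale term of a Taylor cell**: for `N_i = ∑_k ΔJ_{ik}`, `N_j = ∑_k ΔJ_{jk}`
(`J_{ik} = ∫ σ_{ik} dW^k`, `|σ| ≤ M` progressive) and `G` bounded `𝓕_u`-measurable,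
`E[G N_i N_j] = ∑_k E[G ∫_{(u,v]} σ_{ik} σ_{jk} dr]` (the brackets `⟨J_{ik}, J_{jk'}⟩ = δ_{kk'} ∫ σσ`).
[folklore] -/
theorem integral_mul_martingalePart_mul_martingalePart (hW : IsBrownianVec W P)
    {σi Ji σj Jj : Fin d → ℝ≥0 → Ω → ℝ}
    (hσi : ∀ k, IsStronglyProgressive hW.natFiltration (σi k)) (hσiM : ∀ k r ω, |σi k r ω| ≤ M)
    (hJi : ∀ k, IsItoIntegral (σi k) (fun r ω => W r ω k) (Ji k) hW.natFiltration P)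
    (hσj : ∀ k, IsStronglyProgressive hW.natFiltration (σj k)) (hσjM : ∀ k r ω, |σj k r ω| ≤ M)
    (hJj : ∀ k, IsItoIntegral (σj k) (fun r ω => W r ω k) (Jj k) hW.natFiltration P)
    (huv : u ≤ v) (hG : StronglyMeasurable[hW.natFiltration u] G) (hGb : ∀ ω, |G ω| ≤ CG) :
    ∫ ω, G ω * ((∑ k, (Ji k v ω - Ji k u ω)) * (∑ k, (Jj k v ω - Jj k u ω))) ∂P =
      ∑ k, ∫ ω, G ω * (∫ r in Set.Ioc (u : ℝ) v, σi k r.toNNReal ω * σj k r.toNNReal ω) ∂P := by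
  classical
  have hGm : AEStronglyMeasurable G P := (hG.mono (hW.natFiltration.le u)).aestronglyMeasurable
  have hGbdd : ∀ᵐ ω ∂P, ‖G ω‖ ≤ CG := ae_of_all _ fun ω ↦ by simpa [Real.norm_eq_abs] using hGb ω
  have hJi2 : ∀ k (r : ℝ≥0), MemLp (Ji k r) 2 P := fun k r ↦
    IsItoIntegral.memLp_two (martingale_coord hW k) (martingale_coord_sq_sub hW k)
      (memLp_two_coord hW · k) (continuous_coord hW k) (hσi k) (sqErr_ne_top_of_bdd (hσiM k)) (hJi k) r
  have hJj2 : ∀ k (r : ℝ≥0), MemLp (Jj k r) 2 P := fun k r ↦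
    IsItoIntegral.memLp_two (martingale_coord hW k) (martingale_coord_sq_sub hW k)
      (memLp_two_coord hW · k) (continuous_coord hW k) (hσj k) (sqErr_ne_top_of_bdd (hσjM k)) (hJj k) r
  -- expand the product of sums
  have hexp : ∀ ω, G ω * ((∑ k, (Ji k v ω - Ji k u ω)) * (∑ k, (Jj k v ω - Jj k u ω))) =
      ∑ k, ∑ k', G ω * ((Ji k v ω - Ji k u ω) * (Jj k' v ω - Jj k' u ω)) := by
    intro ω
    rw [sum_mul_sum, mul_sum]
    refine sum_congr rfl fun k _ ↦ ?_
    rw [mul_sum]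
  have hint : ∀ k k', Integrable (fun ω ↦ G ω * ((Ji k v ω - Ji k u ω) * (Jj k' v ω - Jj k' u ω))) P :=
    fun k k' ↦ (((hJi2 k v).sub (hJi2 k u)).integrable_mul ((hJj2 k' v).sub (hJj2 k' u))).bdd_mul hGm hGbdd
  simp_rw [hexp]
  rw [integral_finsetSum _ fun k _ ↦ integrable_finsetSum _ fun k' _ ↦ hint k k']
  refine sum_congr rfl fun k _ ↦ ?_
  rw [integral_finsetSum _ fun k' _ ↦ hint k k']
  -- only the diagonal survives
  have hterm : ∀ k', ∫ ω, G ω * ((Ji k v ω - Ji k u ω) * (Jj k' v ω - Jj k' u ω)) ∂P =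
      if k = k' then ∫ ω, G ω * (∫ r in Set.Ioc (u : ℝ) v, σi k r.toNNReal ω * σj k r.toNNReal ω) ∂P
      else 0 := by
    intro k'
    by_cases hkk : k = k'
    · subst hkk
      rw [if_pos rfl]
      exact integral_itoIntegral_coord_mul_sub_self hW k (hσi k) (hσj k) (sqErr_ne_top_of_bdd (hσiM k))
        (sqErr_ne_top_of_bdd (hσjM k)) (hJi k) (hJj k) huv hG hGb
    · rw [if_neg hkk]
      exact integral_itoIntegral_coord_mul_sub_of_ne hW hkk (hσi k) (hσj k') (sqErr_ne_top_of_bdd (hσiM k))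
        (sqErr_ne_top_of_bdd (hσjM k')) (hJi k) (hJj k') huv hG hGb
  simp_rw [hterm]
  rw [sum_ite_eq]
  simp

end Vec

end Summit.QuantumFields.YangMills.Theorems.ColdStartUniversality

end
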